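import Summits.QuantumFields.YangMills.Theorems.UnitScaleTiltProp7SRWHeatKernelRecurrence
import Literature.Probability.LatticeModels.TorusHeatKernel1D
import HarnessLib

/-!
# Route `UnitScaleTilt`, crux K1 «MinimiserStabilityRegPr» (stmt-QuantumFields-19200), route-R E′ path (α′) — the sup-row residue (hK), input of the biharmonic peeling (A3):
# THE SMALL-DISTANCE LETTER ON THE DISCRETE CIRCLE — `|q^L_t(m+1) − q^L_t(m−1)| ≲ (|m̃|∕t)·(1∨t)^{−1∕2}(1 + m̃²∕(1∨t))^{−3}` for `0 < t ≤ L²`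

Cell `ym3-torus`, D-0154 (3c) twin-width seat `ym-routeR-w2` (gen 5); row (R1) part 2∕2 (★routeR-w3 g5 19:29:26Z SWAP word, torus route agreed 19:32:35Z).
THEOREMS ONLY (0 `def`, 0 `sorry`); `--supports stmt-QuantumFields-19200 --as helper`, count-neutral.  YM₃ on T³ is a ladder rung (R3), not the Clay problem;
nothing here claims the stub, the crux, d = 4 or the gap.

THE POINT.  Part 1 (✓ `Prop7SRWHeatKernelRecurrence.srwHeatKernel_sub_eq`) is the exact recurrence `q_t(n−1) − q_t(n+1) = (2n∕t)q_t(n)` on `ℤ`.  On the circle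
`ℤ∕Lℤ` the method of images (✓ `TorusHeatKernel1D.torusHeatKernel_eq_tsum`) gives `q^L_t(m−1) − q^L_t(m+1) = (2∕t)·Σ_w n_w q_t(n_w)`, `n_w = m̃ + wL`
(`torusHeatKernel_symDiff_eq_tsum`).  A TERMWISE bound loses the gain: at `t ≍ L²` the images `|w| = 1` sit at distance `≍ √t` and cost `t⁻¹` each.  What restores the
factor `|m̃|` is the ODD PAIRING `w ↔ −w`: `n_w q(n_w) + n_{−w} q(n_{−w}) = m̃·[q(m̃+wL) + q(m̃−wL)] + wL·[q(m̃+wL) − q(m̃−wL)]`, and by evenness the second bracket is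
`q(wL+m̃) − q(wL−m̃)`, a telescoping sum of `2|m̃|` unit gradients at points of modulus `≥ |w|L∕2` (`abs_pair_grad_le`), so BOTH brackets carry `|m̃|`.

WHAT IS PROVED (ns `…Theorems.Prop7TorusHeatKernelSmallDistance`; letters of lit `TorusHeatKernel1D.torusHeatKernel`, `SRWHeatKernel1D.srwHeatKernel`).
* §1 weights and telescoping: `inv_weight_image_le`, `abs_mul_natCast_mul_inv_le` (`|w|L(1∨t)⁻¹ ≤ 2(1∨t)^{−1∕2}(1 + w²L²∕(4(1∨t)))`), `abs_sub_le_mul_of_fwdDiff`,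
  `abs_sub_symm_le` (`|f(c+r) − f(c−r)| ≤ 2|r|·sup_{|n−c|≤|r|}|∇f(n)|`), `sq_image_le` (`|n − wL| ≤ L∕2, w ≠ 0 ⇒ n² ≥ w²L²∕4`).
* §2 ★ `abs_pair_grad_le` — the paired gradient term `|wL·(q(m̃+wL) − q(m̃−wL))| ≤ 4A′|m̃|(1∨t)^{−1∕2}(1+m̃²∕(1∨t))^{−3}(1+w²∕4)^{−1}`.
* §3 ★★ `torusHeatKernel_symDiff_eq_tsum` — the periodised recurrence; ★★★ `abs_torusHeatKernel_symDiff_le_small` —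
  `∃ K > 0, ∀ L ≥ 1, 0 < t ≤ L², m : |q^L_t(m+1) − q^L_t(m−1)| ≤ K·(|m̃|∕t)·(1∨t)^{−1∕2}·(1 + m̃²∕(1∨t))^{−3}`;
  ★★★ `abs_torusHeatKernel_fwdDiff_le_small` — `|q^L_t(m+1) − q^L_t(m)| ≤ K·((|m̃|+1)∕t)·(1∨t)^{−1∕2}·(1 + m̃²∕(1∨t))^{−3}` (`fwd = ½sym + ½snd`,
  ✓ `abs_torusHeatKernel_sndDiff_le`).
HONEST SCOPE.  1D torus letters; the `d = 3` product and the time integral `∫ s·(…)ds` of the `G₂` bookkeeping are the consumer's ((R2)∕(A3)).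

References: G. F. Lawler, V. Limic, *Random Walk: A Modern Introduction*, CUP 2010 [LawlerLimic2010] (§2.3); T. Bałaban, CMP 96 (1984) 223–250 [Balaban1984PropagatorsII] ((1.9) p.226).
-/

set_option autoImplicit false

noncomputable section

open scoped BigOperators
open Real

namespace Summit.QuantumFields.YangMills.Theorems.Prop7TorusHeatKernelSmallDistance

open Literature.Probability.LatticeModels
open Summit.QuantumFields.YangMills.Theorems.Prop7SRWHeatKernelRecurrence

/-! ### §1 Weights and telescoping -/

/-- For an image index `w ≠ 0`, `2|r| ≤ L` and `1 ≤ T ≤ L²`: `(1 + w²L²∕(4T))^{−4} ≤ (1 + r²∕T)^{−3}(1 + w²∕4)^{−1}` (`w²L²∕(4T) ≥ r²∕T` and `≥ w²∕4`). [folklore] -/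
theorem inv_weight_image_le {r w : ℤ} {L : ℕ} {T : ℝ} (hw : w ≠ 0) (hT1 : 1 ≤ T) (hTL : T ≤ (L : ℝ) ^ 2)
    (hr : 2 * |r| ≤ (L : ℤ)) :
    ((1 + (w : ℝ) ^ 2 * (L : ℝ) ^ 2 / (4 * T)) ^ 4)⁻¹ ≤ ((1 + (r : ℝ) ^ 2 / T) ^ 3)⁻¹ * (1 + (w : ℝ) ^ 2 / 4)⁻¹ := by
  have hT0 : 0 < T := by positivity
  have hLr : 2 * |(r : ℝ)| ≤ L := by
    have h : ((2 * |r| : ℤ) : ℝ) ≤ ((L : ℤ) : ℝ) := by exact_mod_cast hr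
    push_cast at h
    exact h
  have hw1 : (1 : ℝ) ≤ (w : ℝ) ^ 2 := by
    have h : (1 : ℝ) ≤ |(w : ℝ)| := by rw [← Int.cast_abs]; exact_mod_cast Int.one_le_abs hw
    nlinarith [abs_nonneg (w : ℝ), sq_abs (w : ℝ)]
  have hr2 : 4 * (r : ℝ) ^ 2 ≤ (L : ℝ) ^ 2 := by
    have h : (2 * |(r : ℝ)|) ^ 2 ≤ (L : ℝ) ^ 2 := pow_le_pow_left₀ (by positivity) hLr 2
    rw [mul_pow, sq_abs] at h
    linarith
  have h1 : (r : ℝ) ^ 2 / T ≤ (w : ℝ) ^ 2 * (L : ℝ) ^ 2 / (4 * T) := by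
    rw [div_le_div_iff₀ hT0 (by positivity)]
    nlinarith [mul_le_mul_of_nonneg_right hr2 hT0.le, mul_nonneg (mul_nonneg (sub_nonneg.2 hw1) (sq_nonneg (L : ℝ))) hT0.le]
  have h2 : (w : ℝ) ^ 2 / 4 ≤ (w : ℝ) ^ 2 * (L : ℝ) ^ 2 / (4 * T) := by
    rw [div_le_div_iff₀ (by norm_num) (by positivity)]
    nlinarith [mul_le_mul_of_nonneg_left hTL (sq_nonneg (w : ℝ))]
  have hX0 : 0 ≤ (w : ℝ) ^ 2 * (L : ℝ) ^ 2 / (4 * T) := by positivity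
  rw [← mul_inv, inv_le_inv₀ (by positivity) (by positivity)]
  calc (1 + (r : ℝ) ^ 2 / T) ^ 3 * (1 + (w : ℝ) ^ 2 / 4)
      ≤ (1 + (w : ℝ) ^ 2 * (L : ℝ) ^ 2 / (4 * T)) ^ 3 * (1 + (w : ℝ) ^ 2 * (L : ℝ) ^ 2 / (4 * T)) := by gcongr
    _ = (1 + (w : ℝ) ^ 2 * (L : ℝ) ^ 2 / (4 * T)) ^ 4 := by ring

/-- `|w|·L·(1∨t)⁻¹ ≤ 2·(1∨t)^{−1∕2}·(1 + w²L²∕(4(1∨t)))` (with `y = |w|L(1∨t)^{−1∕2}`: `y ≤ 2 + y²∕2`). [folklore] -/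
theorem abs_mul_natCast_mul_inv_le (w : ℤ) (L : ℕ) (t : ℝ) :
    |(w : ℝ)| * L * (max 1 t)⁻¹ ≤ 2 * (max 1 t) ^ (-(1 / 2 : ℝ)) * (1 + (w : ℝ) ^ 2 * (L : ℝ) ^ 2 / (4 * max 1 t)) := by
  have hs0 : 0 < (max 1 t) ^ (-(1 / 2 : ℝ)) := Real.rpow_pos_of_pos (by positivity) _
  have hss : (max 1 t) ^ (-(1 / 2 : ℝ)) * (max 1 t) ^ (-(1 / 2 : ℝ)) = (max 1 t)⁻¹ := max_one_rpow_neg_half_mul_self t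
  have hX : (w : ℝ) ^ 2 * (L : ℝ) ^ 2 / (4 * max 1 t) = (|(w : ℝ)| * L * (max 1 t) ^ (-(1 / 2 : ℝ))) ^ 2 / 4 := by
    rw [div_eq_mul_inv, mul_inv, ← hss, mul_pow, mul_pow, sq_abs]
    ring
  rw [hX, ← hss]
  have hy : 0 ≤ |(w : ℝ)| * L := by positivity
  nlinarith [mul_nonneg hs0.le (sq_nonneg (|(w : ℝ)| * L * (max 1 t) ^ (-(1 / 2 : ℝ)) - 1)), hy, hs0]

/-- Telescoping: if `|f(b+j+1) − f(b+j)| ≤ B` for `j < N` then `|f(b+N) − f(b)| ≤ N·B`. [folklore] -/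
theorem abs_sub_le_mul_of_fwdDiff (f : ℤ → ℝ) (b : ℤ) {B : ℝ} (N : ℕ)
    (h : ∀ j : ℕ, j < N → |f (b + j + 1) - f (b + j)| ≤ B) : |f (b + N) - f b| ≤ N * B := by
  induction N with
  | zero => simp
  | succ n ih =>
    have h1 := ih (fun j hj => h j (Nat.lt_succ_of_lt hj))
    have h2 := h n (Nat.lt_succ_self n)
    have e : b + ((n + 1 : ℕ) : ℤ) = b + n + 1 := by push_cast; ring
    rw [e]
    calc |f (b + n + 1) - f b| = |(f (b + n + 1) - f (b + n)) + (f (b + n) - f b)| := by congr 1; ring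
      _ ≤ |f (b + n + 1) - f (b + n)| + |f (b + n) - f b| := abs_add_le _ _
      _ ≤ B + n * B := add_le_add h2 h1
      _ = ((n + 1 : ℕ) : ℝ) * B := by push_cast; ring

/-- Symmetric telescoping: if `|f(n+1) − f(n)| ≤ B` whenever `|n − c| ≤ |r|`, then `|f(c+r) − f(c−r)| ≤ 2|r|·B`. [folklore] -/
theorem abs_sub_symm_le (f : ℤ → ℝ) (c r : ℤ) {B : ℝ} (h : ∀ n : ℤ, |n - c| ≤ |r| → |f (n + 1) - f n| ≤ B) :
    |f (c + r) - f (c - r)| ≤ 2 * |(r : ℝ)| * B := by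
  obtain ⟨a, ha⟩ : ∃ a : ℕ, r.natAbs = a := ⟨_, rfl⟩
  have hra : |r| = (a : ℤ) := by rw [← Int.natCast_natAbs, ha]
  have main : |f (c + a) - f (c - a)| ≤ 2 * (a : ℝ) * B := by
    have hw : ∀ j : ℕ, j < 2 * a → |f (c - a + j + 1) - f (c - a + j)| ≤ B := fun j hj => by
      apply h
      rw [hra, show c - (a : ℤ) + j - c = (j : ℤ) - a by ring, abs_le]
      constructor <;> omega
    have hN := abs_sub_le_mul_of_fwdDiff f (c - a) (2 * a) hw
    rw [show c - (a : ℤ) + ((2 * a : ℕ) : ℤ) = c + a by push_cast; ring] at hN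
    calc |f (c + a) - f (c - a)| ≤ ((2 * a : ℕ) : ℝ) * B := hN
      _ = 2 * (a : ℝ) * B := by push_cast; ring
  have hrR : |(r : ℝ)| = (a : ℝ) := by rw [← Int.cast_abs, hra, Int.cast_natCast]
  rw [hrR]
  rcases Int.natAbs_eq r with hr | hr
  · rw [ha] at hr; rw [hr]; exact main
  · rw [ha] at hr; rw [hr, ← sub_eq_add_neg, sub_neg_eq_add, abs_sub_comm]; exact main

/-- Images stay far: if `w ≠ 0` and `2|n − wL| ≤ L` then `w²L²∕4 ≤ n²`. [folklore] -/
theorem sq_image_le {n w : ℤ} {L : ℕ} (hw : w ≠ 0) (h : 2 * |n - w * L| ≤ (L : ℤ)) :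
    (w : ℝ) ^ 2 * (L : ℝ) ^ 2 / 4 ≤ (n : ℝ) ^ 2 := by
  have hw1 : (1 : ℝ) ≤ |(w : ℝ)| := by rw [← Int.cast_abs]; exact_mod_cast Int.one_le_abs hw
  have hL0 : (0 : ℝ) ≤ L := Nat.cast_nonneg L
  have h' : 2 * |(n : ℝ) - w * L| ≤ L := by
    have hc : ((2 * |n - w * L| : ℤ) : ℝ) ≤ ((L : ℤ) : ℝ) := by exact_mod_cast h
    push_cast at hc
    exact hc
  have h1 : |(w : ℝ)| * L - |(n : ℝ) - w * L| ≤ |(n : ℝ)| := by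
    have hh := abs_sub_abs_le_abs_sub ((w : ℝ) * L) ((w : ℝ) * L - n)
    rw [abs_mul, Nat.abs_cast, show (w : ℝ) * L - ((w : ℝ) * L - n) = n by ring, abs_sub_comm ((w : ℝ) * L) (n : ℝ)] at hh
    linarith
  have h2 : |(w : ℝ)| * L / 2 ≤ |(n : ℝ)| := by nlinarith [mul_nonneg (sub_nonneg.2 hw1) hL0]
  have h2' : 0 ≤ |(w : ℝ)| * L / 2 := by positivity
  nlinarith [mul_le_mul h2 h2 h2' (abs_nonneg _), sq_abs (n : ℝ), sq_abs (w : ℝ)]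

/-! ### §2 The paired gradient term -/

/-- ★ **Odd pairing, gradient bracket**: given the uniform gradient bound `|q_t(n+1) − q_t(n)| ≤ A(1∨t)⁻¹(1 + n²∕(1∨t))^{−5}` on `ℤ`, for `2|r| ≤ L`, `t ≤ L²` and every
image index `w`, `|wL·(q_t(r + wL) − q_t(r − wL))| ≤ 4A|r|(1∨t)^{−1∕2}·(1 + r²∕(1∨t))^{−3}(1 + w²∕4)^{−1}` (evenness `q(r − wL) = q(wL − r)`, a telescoping sum of `2|r|`
unit gradients at points `n` with `|n| ≥ |w|L∕2`, and `|w|L(1∨t)⁻¹ ≤ 2(1∨t)^{−1∕2}(1 + w²L²∕(4(1∨t)))`). [cite: LawlerLimic2010, §2.3] -/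
theorem abs_pair_grad_le {L : ℕ} {t A : ℝ} {r : ℤ} (hA : 0 ≤ A) (htL : t ≤ (L : ℝ) ^ 2) (hr : 2 * |r| ≤ (L : ℤ))
    (hq : ∀ n : ℤ, |srwHeatKernel t (n + 1) - srwHeatKernel t n| ≤ A * (max 1 t)⁻¹ * ((1 + (n : ℝ) ^ 2 / max 1 t) ^ 5)⁻¹) (w : ℤ) :
    |(w : ℝ) * L * (srwHeatKernel t (r + w * L) - srwHeatKernel t (r - w * L))| ≤
      4 * A * |(r : ℝ)| * (max 1 t) ^ (-(1 / 2 : ℝ)) * (((1 + (r : ℝ) ^ 2 / max 1 t) ^ 3)⁻¹ * (1 + (w : ℝ) ^ 2 / 4)⁻¹) := by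
  rcases eq_or_ne w 0 with rfl | hw
  · simp only [Int.cast_zero, zero_mul, abs_zero]; positivity
  rcases Nat.eq_zero_or_pos L with hL | hL
  · subst hL; simp only [Nat.cast_zero, mul_zero, zero_mul, abs_zero]; positivity
  have hL1 : (1 : ℝ) ≤ L := by exact_mod_cast hL
  have hT1 : (1 : ℝ) ≤ max 1 t := le_max_left _ _
  have hT0 : (0 : ℝ) < max 1 t := by positivity
  have hTL : max 1 t ≤ (L : ℝ) ^ 2 := max_le (by nlinarith) htL
  have hX0 : 0 ≤ (w : ℝ) ^ 2 * (L : ℝ) ^ 2 / (4 * max 1 t) := by positivity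
  have hX1 : (1 + (w : ℝ) ^ 2 * (L : ℝ) ^ 2 / (4 * max 1 t)) ≠ 0 := by positivity
  -- evenness
  have hev : srwHeatKernel t (r - w * L) = srwHeatKernel t (w * L - r) := by rw [← srwHeatKernel_neg, neg_sub]
  -- the gradient is uniformly small on the window `|n − wL| ≤ |r|`
  have hwin : ∀ n : ℤ, |n - w * L| ≤ |r| → |srwHeatKernel t (n + 1) - srwHeatKernel t n| ≤
      A * (max 1 t)⁻¹ * ((1 + (w : ℝ) ^ 2 * (L : ℝ) ^ 2 / (4 * max 1 t)) ^ 5)⁻¹ := by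
    intro n hn
    have h2n : 2 * |n - w * L| ≤ (L : ℤ) := by linarith
    have hsq := sq_image_le hw h2n
    have hXn : (w : ℝ) ^ 2 * (L : ℝ) ^ 2 / (4 * max 1 t) ≤ (n : ℝ) ^ 2 / max 1 t := by
      rw [div_le_div_iff₀ (by positivity) hT0]
      nlinarith [mul_le_mul_of_nonneg_right hsq hT0.le]
    calc _ ≤ A * (max 1 t)⁻¹ * ((1 + (n : ℝ) ^ 2 / max 1 t) ^ 5)⁻¹ := hq n
      _ ≤ A * (max 1 t)⁻¹ * ((1 + (w : ℝ) ^ 2 * (L : ℝ) ^ 2 / (4 * max 1 t)) ^ 5)⁻¹ := by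
          apply mul_le_mul_of_nonneg_left _ (by positivity)
          exact inv_anti₀ (by positivity) (pow_le_pow_left₀ (by positivity) (by linarith) 5)
  have hgrad := abs_sub_symm_le (fun n => srwHeatKernel t n) (w * L) r hwin
  have hdiff : |srwHeatKernel t (r + w * L) - srwHeatKernel t (r - w * L)| ≤
      2 * |(r : ℝ)| * (A * (max 1 t)⁻¹ * ((1 + (w : ℝ) ^ 2 * (L : ℝ) ^ 2 / (4 * max 1 t)) ^ 5)⁻¹) := by
    rw [hev, add_comm]
    exact hgrad
  have hwL := abs_mul_natCast_mul_inv_le w L t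
  have hkey := inv_weight_image_le hw hT1 hTL hr
  have e5 : (1 + (w : ℝ) ^ 2 * (L : ℝ) ^ 2 / (4 * max 1 t)) * ((1 + (w : ℝ) ^ 2 * (L : ℝ) ^ 2 / (4 * max 1 t)) ^ 5)⁻¹ =
      ((1 + (w : ℝ) ^ 2 * (L : ℝ) ^ 2 / (4 * max 1 t)) ^ 4)⁻¹ := by
    field_simp
  rw [abs_mul, abs_mul, Nat.abs_cast]
  calc |(w : ℝ)| * L * |srwHeatKernel t (r + w * L) - srwHeatKernel t (r - w * L)|
      ≤ |(w : ℝ)| * L * (2 * |(r : ℝ)| * (A * (max 1 t)⁻¹ * ((1 + (w : ℝ) ^ 2 * (L : ℝ) ^ 2 / (4 * max 1 t)) ^ 5)⁻¹)) := by gcongr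
    _ = 2 * A * |(r : ℝ)| * (|(w : ℝ)| * L * (max 1 t)⁻¹) * ((1 + (w : ℝ) ^ 2 * (L : ℝ) ^ 2 / (4 * max 1 t)) ^ 5)⁻¹ := by ring
    _ ≤ 2 * A * |(r : ℝ)| * (2 * (max 1 t) ^ (-(1 / 2 : ℝ)) * (1 + (w : ℝ) ^ 2 * (L : ℝ) ^ 2 / (4 * max 1 t))) *
          ((1 + (w : ℝ) ^ 2 * (L : ℝ) ^ 2 / (4 * max 1 t)) ^ 5)⁻¹ := by gcongr
    _ = 4 * A * |(r : ℝ)| * (max 1 t) ^ (-(1 / 2 : ℝ)) * ((1 + (w : ℝ) ^ 2 * (L : ℝ) ^ 2 / (4 * max 1 t)) ^ 4)⁻¹ := by rw [← e5]; ring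
    _ ≤ 4 * A * |(r : ℝ)| * (max 1 t) ^ (-(1 / 2 : ℝ)) * (((1 + (r : ℝ) ^ 2 / max 1 t) ^ 3)⁻¹ * (1 + (w : ℝ) ^ 2 / 4)⁻¹) := by gcongr

/-! ### §3 The periodised recurrence and the small-distance rows -/

variable {L : ℕ} [NeZero L]

/-- ★★ **The periodised recurrence**: for `t > 0` and `m ∈ ℤ∕Lℤ` with centred representative `r` (`(r : ℤ∕Lℤ) = m`), the image functions `w ↦ (r + wL)q_t(r + wL)` are summable and
`q^L_t(m+1) − q^L_t(m−1) = −(2∕t)·Σ_w (r + wL)·q_t(r + wL)` (✓ `torusHeatKernel_eq_tsum` + ✓ `srwHeatKernel_sub_eq` termwise). [cite: LawlerLimic2010, §2.3] -/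
theorem torusHeatKernel_symDiff_eq_tsum {t : ℝ} (ht : 0 < t) {r : ℤ} {m : ZMod L} (hcast : ((r : ℤ) : ZMod L) = m) :
    Summable (fun w : ℤ => ((r + w * L : ℤ) : ℝ) * srwHeatKernel t (r + w * L)) ∧
      torusHeatKernel t (m + 1) - torusHeatKernel t (m - 1) = -(2 / t) * ∑' w : ℤ, ((r + w * L : ℤ) : ℝ) * srwHeatKernel t (r + w * L) := by
  obtain ⟨hsP, hrepP⟩ := torusHeatKernel_eq_tsum (L := L) ht (r + 1)
  obtain ⟨hsM, hrepM⟩ := torusHeatKernel_eq_tsum (L := L) ht (r - 1)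
  rw [Int.cast_add, Int.cast_one, hcast] at hrepP
  rw [Int.cast_sub, Int.cast_one, hcast] at hrepM
  have hgq : ∀ w : ℤ, srwHeatKernel t (r + 1 + w * L) - srwHeatKernel t (r - 1 + w * L) =
      -(2 / t) * (((r + w * L : ℤ) : ℝ) * srwHeatKernel t (r + w * L)) := by
    intro w
    rw [show r + 1 + w * L = r + w * L + 1 by ring, show r - 1 + w * L = r + w * L - 1 by ring]
    have h := srwHeatKernel_sub_eq ht.ne' (r + w * L)
    linear_combination (-1 : ℝ) * h
  have htne : t ≠ 0 := ht.ne'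
  have hgs : Summable (fun w : ℤ => ((r + w * L : ℤ) : ℝ) * srwHeatKernel t (r + w * L)) := by
    refine ((hsP.sub hsM).mul_left (-(t / 2))).congr fun w => ?_
    rw [hgq w]
    field_simp
  refine ⟨hgs, ?_⟩
  rw [hrepP, hrepM, ← hsP.tsum_sub hsM, ← tsum_mul_left]
  exact tsum_congr hgq

/-- ★★★ **THE SMALL-DISTANCE ROW ON THE CIRCLE (symmetric difference)**: there is `K > 0` such that for all `L ≥ 1`, `0 < t ≤ L²` and `m ∈ ℤ∕Lℤ`,
`|q^L_t(m+1) − q^L_t(m−1)| ≤ K·(|m̃|∕t)·(1∨t)^{−1∕2}·(1 + m̃²∕(1∨t))^{−3}` (`m̃ = valMinAbs m`): the periodised recurrence summed over the odd pairs `w ↔ −w`,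
the bracket `m̃·[q(m̃+wL) + q(m̃−wL)]` by ✓ `tsum_abs_periodize_le` and the bracket `wL·[q(m̃+wL) − q(m̃−wL)]` by `abs_pair_grad_le`. [cite: LawlerLimic2010, §2.3] -/
theorem abs_torusHeatKernel_symDiff_le_small : ∃ K : ℝ, 0 < K ∧ ∀ (L : ℕ) [NeZero L] (t : ℝ), 0 < t → t ≤ (L : ℝ) ^ 2 → ∀ m : ZMod L,
    |torusHeatKernel t (m + 1) - torusHeatKernel t (m - 1)| ≤
      K * (|(m.valMinAbs : ℝ)| / t) * (max 1 t) ^ (-(1 / 2 : ℝ)) * ((1 + (m.valMinAbs : ℝ) ^ 2 / max 1 t) ^ 3)⁻¹ := by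
  obtain ⟨A, hA, hqA⟩ := srwHeatKernel_decay 4
  obtain ⟨A', hA', hqA'⟩ := srwHeatKernel_fwdDiff_decay 5
  have hS1 : (1 : ℝ) ≤ ∑' w : ℤ, (1 + (w : ℝ) ^ 2 / 4)⁻¹ := one_le_tsum_inv_one_add_sq_div_four
  refine ⟨(2 * A + 4 * A') * ∑' w : ℤ, (1 + (w : ℝ) ^ 2 / 4)⁻¹, by positivity, ?_⟩
  intro L _ t ht htL m
  have hcast : ((m.valMinAbs : ℤ) : ZMod L) = m := ZMod.coe_valMinAbs m
  have hrL := two_mul_abs_valMinAbs_le m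
  generalize m.valMinAbs = r at hcast hrL ⊢
  have hL1 : (1 : ℝ) ≤ L := by exact_mod_cast Nat.one_le_iff_ne_zero.2 (NeZero.ne L)
  have hT0 : (0 : ℝ) < max 1 t := by positivity
  have hTL : max 1 t ≤ (L : ℝ) ^ 2 := max_le (by nlinarith) htL
  have hs0 : 0 < (max 1 t) ^ (-(1 / 2 : ℝ)) := Real.rpow_pos_of_pos hT0 _
  have hW0 : 0 < ((1 + (r : ℝ) ^ 2 / max 1 t) ^ 3)⁻¹ := by positivity
  -- the periodised recurrence and the odd pairing
  obtain ⟨hgs, hdiff⟩ := torusHeatKernel_symDiff_eq_tsum (L := L) ht hcast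
  set g : ℤ → ℝ := fun w => ((r + w * L : ℤ) : ℝ) * srwHeatKernel t (r + w * L) with hg
  have hgn : Summable (fun w : ℤ => g (-w)) := hgs.comp_injective neg_injective
  have hneg : ∑' w : ℤ, g (-w) = ∑' w : ℤ, g w := by
    have h := (Equiv.neg ℤ).tsum_eq g
    simp only [Equiv.neg_apply] at h
    exact h
  have hpair : 2 * ∑' w : ℤ, g w = ∑' w : ℤ, (g w + g (-w)) := by rw [hgs.tsum_add hgn, hneg, two_mul]
  -- image sums of `|q|`
  obtain ⟨hq0, -⟩ := torusHeatKernel_eq_tsum (L := L) ht r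
  have hq0n : Summable (fun w : ℤ => srwHeatKernel t (r + -w * L)) := hq0.comp_injective neg_injective
  have hnegq : ∑' w : ℤ, |srwHeatKernel t (r + -w * L)| = ∑' w : ℤ, |srwHeatKernel t (r + w * L)| := by
    simpa using (Equiv.neg ℤ).tsum_eq (fun w => |srwHeatKernel t (r + w * L)|)
  have hA_sum := (tsum_abs_periodize_le (L := L) (f := fun n => srwHeatKernel t n) (B := A * (max 1 t) ^ (-(1 / 2 : ℝ)))
    (by positivity) (le_max_left 1 t) hTL (fun n => hqA t ht n) hrL).2
  -- pointwise bound of a pair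
  have hpt : ∀ w : ℤ, |g w + g (-w)| ≤
      |(r : ℝ)| * |srwHeatKernel t (r + w * L)| + |(r : ℝ)| * |srwHeatKernel t (r + -w * L)| +
        4 * A' * |(r : ℝ)| * (max 1 t) ^ (-(1 / 2 : ℝ)) * (((1 + (r : ℝ) ^ 2 / max 1 t) ^ 3)⁻¹ * (1 + (w : ℝ) ^ 2 / 4)⁻¹) := by
    intro w
    have e : g w + g (-w) = (r : ℝ) * (srwHeatKernel t (r + w * L) + srwHeatKernel t (r + -w * L)) +
        (w : ℝ) * L * (srwHeatKernel t (r + w * L) - srwHeatKernel t (r + -w * L)) := by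
      rw [hg]
      push_cast
      ring
    have hB := abs_pair_grad_le hA'.le htL hrL (fun n => hqA' t ht n) w
    rw [show r - w * (L : ℤ) = r + -w * L by ring] at hB
    rw [e]
    calc _ ≤ |(r : ℝ) * (srwHeatKernel t (r + w * L) + srwHeatKernel t (r + -w * L))| +
          |(w : ℝ) * L * (srwHeatKernel t (r + w * L) - srwHeatKernel t (r + -w * L))| := abs_add_le _ _
      _ ≤ (|(r : ℝ)| * |srwHeatKernel t (r + w * L)| + |(r : ℝ)| * |srwHeatKernel t (r + -w * L)|) +
          4 * A' * |(r : ℝ)| * (max 1 t) ^ (-(1 / 2 : ℝ)) * (((1 + (r : ℝ) ^ 2 / max 1 t) ^ 3)⁻¹ * (1 + (w : ℝ) ^ 2 / 4)⁻¹) := by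
          gcongr ?_ + ?_
          rw [abs_mul, ← mul_add]
          exact mul_le_mul_of_nonneg_left (abs_add_le _ _) (abs_nonneg _)
  -- the majorant is summable and sums to the claimed bound
  have hΨs : Summable (fun w : ℤ => |(r : ℝ)| * |srwHeatKernel t (r + w * L)| + |(r : ℝ)| * |srwHeatKernel t (r + -w * L)| +
      4 * A' * |(r : ℝ)| * (max 1 t) ^ (-(1 / 2 : ℝ)) * (((1 + (r : ℝ) ^ 2 / max 1 t) ^ 3)⁻¹ * (1 + (w : ℝ) ^ 2 / 4)⁻¹)) :=
    ((hq0.abs.mul_left _).add (hq0n.abs.mul_left _)).add ((summable_inv_one_add_sq_div_four.mul_left _).mul_left _)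
  have hhs : Summable (fun w : ℤ => |g w + g (-w)|) := (hgs.add hgn).abs
  have hsum_le := Summable.tsum_le_tsum hpt hhs hΨs
  rw [((hq0.abs.mul_left _).add (hq0n.abs.mul_left _)).tsum_add ((summable_inv_one_add_sq_div_four.mul_left _).mul_left _),
    (hq0.abs.mul_left _).tsum_add (hq0n.abs.mul_left _), tsum_mul_left, tsum_mul_left, tsum_mul_left, tsum_mul_left, hnegq] at hsum_le
  have htsum_abs : |∑' w : ℤ, (g w + g (-w))| ≤ ∑' w : ℤ, |g w + g (-w)| := by
    have h := norm_tsum_le_tsum_norm (hgs.add hgn).norm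
    simpa only [Real.norm_eq_abs] using h
  have hfinal : |∑' w : ℤ, (g w + g (-w))| ≤
      (2 * A + 4 * A') * (∑' w : ℤ, (1 + (w : ℝ) ^ 2 / 4)⁻¹) * |(r : ℝ)| * (max 1 t) ^ (-(1 / 2 : ℝ)) * ((1 + (r : ℝ) ^ 2 / max 1 t) ^ 3)⁻¹ := by
    calc _ ≤ ∑' w : ℤ, |g w + g (-w)| := htsum_abs
      _ ≤ |(r : ℝ)| * ∑' w : ℤ, |srwHeatKernel t (r + w * L)| + |(r : ℝ)| * ∑' w : ℤ, |srwHeatKernel t (r + w * L)| +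
            4 * A' * |(r : ℝ)| * (max 1 t) ^ (-(1 / 2 : ℝ)) * (((1 + (r : ℝ) ^ 2 / max 1 t) ^ 3)⁻¹ * ∑' w : ℤ, (1 + (w : ℝ) ^ 2 / 4)⁻¹) := hsum_le
      _ ≤ |(r : ℝ)| * (A * (max 1 t) ^ (-(1 / 2 : ℝ)) * (∑' w : ℤ, (1 + (w : ℝ) ^ 2 / 4)⁻¹) * ((1 + (r : ℝ) ^ 2 / max 1 t) ^ 3)⁻¹) +
            |(r : ℝ)| * (A * (max 1 t) ^ (-(1 / 2 : ℝ)) * (∑' w : ℤ, (1 + (w : ℝ) ^ 2 / 4)⁻¹) * ((1 + (r : ℝ) ^ 2 / max 1 t) ^ 3)⁻¹) +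
            4 * A' * |(r : ℝ)| * (max 1 t) ^ (-(1 / 2 : ℝ)) * (((1 + (r : ℝ) ^ 2 / max 1 t) ^ 3)⁻¹ * ∑' w : ℤ, (1 + (w : ℝ) ^ 2 / 4)⁻¹) := by
          gcongr
      _ = _ := by ring
  rw [hdiff, abs_mul, abs_neg, abs_div, abs_two, abs_of_pos ht]
  calc 2 / t * |∑' w : ℤ, g w| = (1 / t) * |∑' w : ℤ, (g w + g (-w))| := by rw [← hpair, abs_mul, abs_two]; ring
    _ ≤ (1 / t) * ((2 * A + 4 * A') * (∑' w : ℤ, (1 + (w : ℝ) ^ 2 / 4)⁻¹) * |(r : ℝ)| * (max 1 t) ^ (-(1 / 2 : ℝ)) * ((1 + (r : ℝ) ^ 2 / max 1 t) ^ 3)⁻¹) := by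
        gcongr
    _ = _ := by ring

/-- ★★★ **THE SMALL-DISTANCE ROW ON THE CIRCLE (forward difference)**: there is `K > 0` such that for all `L ≥ 1`, `0 < t ≤ L²` and `m ∈ ℤ∕Lℤ`,
`|q^L_t(m+1) − q^L_t(m)| ≤ K·((|m̃|+1)∕t)·(1∨t)^{−1∕2}·(1 + m̃²∕(1∨t))^{−3}` (`fwd = ½·sym + ½·snd`, ✓ `abs_torusHeatKernel_sndDiff_le`, `(1∨t)⁻¹ ≤ t⁻¹`); for `1 ≤ t ≤ L²`
this is the `(|m̃|+1)·t^{−3∕2}`×Gaussian row requested for (R2)∕(A3). [cite: LawlerLimic2010, §2.3] -/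
theorem abs_torusHeatKernel_fwdDiff_le_small : ∃ K : ℝ, 0 < K ∧ ∀ (L : ℕ) [NeZero L] (t : ℝ), 0 < t → t ≤ (L : ℝ) ^ 2 → ∀ m : ZMod L,
    |torusHeatKernel t (m + 1) - torusHeatKernel t m| ≤
      K * ((|(m.valMinAbs : ℝ)| + 1) / t) * (max 1 t) ^ (-(1 / 2 : ℝ)) * ((1 + (m.valMinAbs : ℝ) ^ 2 / max 1 t) ^ 3)⁻¹ := by
  obtain ⟨K₁, hK₁, h₁⟩ := abs_torusHeatKernel_symDiff_le_small
  obtain ⟨K₂, hK₂, h₂⟩ := abs_torusHeatKernel_sndDiff_le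
  refine ⟨K₁ + K₂, by positivity, ?_⟩
  intro L _ t ht htL m
  have g1 := h₁ L t ht htL m
  have g2 := h₂ L t ht htL m
  have hT0 : (0 : ℝ) < max 1 t := by positivity
  have hmax : (max 1 t)⁻¹ ≤ t⁻¹ := by
    rw [inv_le_inv₀ hT0 ht]; exact le_max_right 1 t
  have hW0 : 0 ≤ (max 1 t) ^ (-(1 / 2 : ℝ)) * ((1 + (m.valMinAbs : ℝ) ^ 2 / max 1 t) ^ 3)⁻¹ := by positivity
  have g2' : |torusHeatKernel t (m + 1) - 2 * torusHeatKernel t m + torusHeatKernel t (m - 1)| ≤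
      K₂ * t⁻¹ * ((max 1 t) ^ (-(1 / 2 : ℝ)) * ((1 + (m.valMinAbs : ℝ) ^ 2 / max 1 t) ^ 3)⁻¹) := by
    calc _ ≤ _ := g2
      _ = K₂ * (max 1 t)⁻¹ * ((max 1 t) ^ (-(1 / 2 : ℝ)) * ((1 + (m.valMinAbs : ℝ) ^ 2 / max 1 t) ^ 3)⁻¹) := by ring
      _ ≤ _ := by gcongr
  have e : torusHeatKernel t (m + 1) - torusHeatKernel t m = (1 / 2) * (torusHeatKernel t (m + 1) - torusHeatKernel t (m - 1)) +
      (1 / 2) * (torusHeatKernel t (m + 1) - 2 * torusHeatKernel t m + torusHeatKernel t (m - 1)) := by ring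
  rw [e]
  have hm0 : 0 ≤ |(m.valMinAbs : ℝ)| := abs_nonneg _
  have ht0 : 0 ≤ t⁻¹ := by positivity
  calc _ ≤ |(1 / 2) * (torusHeatKernel t (m + 1) - torusHeatKernel t (m - 1))| +
        |(1 / 2) * (torusHeatKernel t (m + 1) - 2 * torusHeatKernel t m + torusHeatKernel t (m - 1))| := abs_add_le _ _
    _ = 1 / 2 * |torusHeatKernel t (m + 1) - torusHeatKernel t (m - 1)| +
        1 / 2 * |torusHeatKernel t (m + 1) - 2 * torusHeatKernel t m + torusHeatKernel t (m - 1)| := by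
        rw [abs_mul, abs_mul, abs_of_pos (by norm_num : (0 : ℝ) < 1 / 2)]
    _ ≤ 1 / 2 * (K₁ * (|(m.valMinAbs : ℝ)| / t) * (max 1 t) ^ (-(1 / 2 : ℝ)) * ((1 + (m.valMinAbs : ℝ) ^ 2 / max 1 t) ^ 3)⁻¹) +
        1 / 2 * (K₂ * t⁻¹ * ((max 1 t) ^ (-(1 / 2 : ℝ)) * ((1 + (m.valMinAbs : ℝ) ^ 2 / max 1 t) ^ 3)⁻¹)) := by gcongr
    _ ≤ _ := by
        have hd1 : (|(m.valMinAbs : ℝ)| + 1) / t = (|(m.valMinAbs : ℝ)| + 1) * t⁻¹ := div_eq_mul_inv _ _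
        have hd2 : |(m.valMinAbs : ℝ)| / t = |(m.valMinAbs : ℝ)| * t⁻¹ := div_eq_mul_inv _ _
        rw [hd1, hd2]
        have p1 : 0 ≤ K₁ * |(m.valMinAbs : ℝ)| * t⁻¹ * ((max 1 t) ^ (-(1 / 2 : ℝ)) * ((1 + (m.valMinAbs : ℝ) ^ 2 / max 1 t) ^ 3)⁻¹) := by positivity
        have p2 : 0 ≤ K₂ * t⁻¹ * ((max 1 t) ^ (-(1 / 2 : ℝ)) * ((1 + (m.valMinAbs : ℝ) ^ 2 / max 1 t) ^ 3)⁻¹) := by positivity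
        have p3 : 0 ≤ K₂ * |(m.valMinAbs : ℝ)| * t⁻¹ * ((max 1 t) ^ (-(1 / 2 : ℝ)) * ((1 + (m.valMinAbs : ℝ) ^ 2 / max 1 t) ^ 3)⁻¹) := by positivity
        have p4 : 0 ≤ K₁ * t⁻¹ * ((max 1 t) ^ (-(1 / 2 : ℝ)) * ((1 + (m.valMinAbs : ℝ) ^ 2 / max 1 t) ^ 3)⁻¹) := by positivity
        nlinarith [p1, p2, p3, p4]

end Summit.QuantumFields.YangMills.Theorems.Prop7TorusHeatKernelSmallDistance
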